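import Literature.AlgebraicGeometry.Frobenioids.ZetaUnitMap
import HarnessLib

/-!
# Frobenioids I, Proposition 2.9 (ii): the unit-wise Frobenius functor `Ψ` for `(τ, ζ)`

Mochizuki, *The geometry of Frobenioids I: the general theory*, Kyushu J. Math. **62** (2008)
293–400, §2, proof of Proposition 2.9 (ii), kurims text pp.54–55
[cite: MochizukiFrdI2008, Prop. 2.9(ii) p.54]: "every morphism `φ` of `C` admits a unique
factorization `φ = α ∘ β ∘ γ` … Set `Ψ(β) := β₀^ζ · β₁`; `Ψ(φ) := α ∘ Ψ(β) ∘ γ`.  Since `β` is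
completely determined by `φ`, it follows that `Ψ` is well-defined … compatible with composites,
hence determines a functor `Ψ : C → C`.  Moreover … `Ψ` satisfies property (a)."

The paper assumes `C` is a skeleton; we instead define `Ψ_P` on arrows between objects of the
base-section `P` (`psiHom`, well-defined by `existsUnique_factorization`, functorial by
`factor_comp` and the properties of `zetaUnitMap`), choose for every object `A` an object
`A_P ∈ Ob(P)` with `i_A : A ≅ A_P` (`P → D` essentially surjective, base-triviality), and set
`Ψ(A) := A_P`, `Ψ(φ) := Ψ_P(i_A⁻¹ ; φ ; i_B)` (`psi`).  Property (a): `F(Ψ_P φ) = F(φ)` on the nose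
(`map_psiHom`), whence `Ψ ⋙ F ≅ F` (`psi_oneCommutes`).
-/

noncomputable section

namespace Literature.AlgebraicGeometry.Frobenioids

open CategoryTheory Opposite

universe w v v' u u'

namespace PreFrobenioid

namespace UnitWiseFrobeniusZeta

variable {D : Type u} [Category.{v} D] {Φ : Dᵒᵖ ⥤ CommMonCat.{w}}
  {C : Type u'} [Category.{v'} C] {F : C ⥤ ElemFrobenioid Φ}
  (hF : IsFrobenioid F) (τ : CharacteristicSplitting F) (hnorm : IsOfType (IsFrobeniusNormalized F))
  (hbt : IsOfType (IsBaseTrivial F)) (histr : IsOfIsotropicType F) (hup : IsOfUnitProfiniteType F)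
  {P : Presection C} {Fr : ℕ+ →* End P.ι} (hpair : IsBaseFrobeniusPair F P Fr) (ζ : Nat.Primes → ℕ+)

open BaseFrobeniusPair

/-! ### `Ψ_P` on arrows between objects of `P` -/

/-- The factorization datum `(n, β, α)` of `φ : A → B`, `A, B ∈ Ob(P)` (Remark 2.7.2).
[cite: MochizukiFrdI2008, Rem. 2.7.2 p.52] -/
def factorOf {A B : C} (hA : P.obj A) (hB : P.obj B) (φ : A ⟶ B) : Factor (F := F) P A B :=
  (existsUnique_factorization hF hpair.isBaseSection hpair.isFrobeniusSection hA hB φ).choose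

/-- `φ = F(n)_A ; β ; α` for `(n, β, α) = factorOf φ`. [cite: MochizukiFrdI2008, Rem. 2.7.2 p.52] -/
theorem toHom_factorOf {A B : C} (hA : P.obj A) (hB : P.obj B) (φ : A ⟶ B) :
    Factor.toHom Fr hA (factorOf hF hpair hA hB φ) = φ :=
  (existsUnique_factorization hF hpair.isBaseSection hpair.isFrobeniusSection hA hB φ).choose_spec.1

/-- Uniqueness: any factorization datum of `φ` is `factorOf φ`. [cite: MochizukiFrdI2008, Rem. 2.7.2 p.52] -/
theorem factorOf_eq {A B : C} (hA : P.obj A) (hB : P.obj B) {φ : A ⟶ B} {t : Factor (F := F) P A B}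
    (h : Factor.toHom Fr hA t = φ) : factorOf hF hpair hA hB φ = t :=
  ((existsUnique_factorization hF hpair.isBaseSection hpair.isFrobeniusSection hA hB φ).choose_spec.2 t h).symm

/-- **`Ψ_P(φ) := α ∘ Ψ(β) ∘ γ`** for `φ = α ∘ β ∘ γ` (printed order), i.e. `F(n)_A ; Ψ_A(β) ; α`.
[cite: MochizukiFrdI2008, Prop. 2.9(ii) p.54] -/
def psiHom {A B : C} (hA : P.obj A) (hB : P.obj B) (φ : A ⟶ B) : A ⟶ B :=
  frob Fr (factorOf hF hpair hA hB φ).1 hA ≫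
    ((zetaUnitMap hF hup ζ τ (histr A) (factorOf hF hpair hA hB φ).2.1).1 : A ⟶ A) ≫
      (factorOf hF hpair hA hB φ).2.2.1

/-- `Ψ_P` on a factored arrow. [cite: MochizukiFrdI2008, Prop. 2.9(ii) p.54] -/
theorem psiHom_factor {A B : C} (hA : P.obj A) (hB : P.obj B) (n : ℕ+) (β : endSubmonoid F A)
    {α : A ⟶ B} (hα : P.hom α) :
    psiHom hF τ histr hup hpair ζ hA hB (frob Fr n hA ≫ (β.1 : A ⟶ A) ≫ α) =
      frob Fr n hA ≫ ((zetaUnitMap hF hup ζ τ (histr A) β).1 : A ⟶ A) ≫ α := by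
  have h := factorOf_eq hF hpair hA hB (φ := frob Fr n hA ≫ (β.1 : A ⟶ A) ≫ α) (t := (n, β, ⟨α, hα⟩)) rfl
  unfold psiHom
  rw [h]

/-- `Ψ_P(id) = id`. [cite: MochizukiFrdI2008, Prop. 2.9(ii) p.55] -/
theorem psiHom_id {A : C} (hA : P.obj A) : psiHom hF τ histr hup hpair ζ hA hA (𝟙 A) = 𝟙 A := by
  have h1 : (𝟙 A : A ⟶ A) = frob Fr 1 hA ≫ ((1 : endSubmonoid F A).1 : A ⟶ A) ≫ 𝟙 A := by
    rw [frob_one, Category.id_comp, Category.comp_id]; rfl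
  conv_lhs => rw [h1]
  rw [psiHom_factor hF τ histr hup hpair ζ hA hA 1 1 (P.hom_id hA), map_one, frob_one, Category.id_comp,
    Category.comp_id]
  rfl

include hnorm in
/-- `Ψ_P` is compatible with composites ("it follows from the definition of `P`- and
`F`-distinguished morphisms [together with the fact that raising to the `ζ`-th power defines an
endomorphism of the functor in monoids `O^×(−)` … which commutes with raising to the `d`-th power]").
[cite: MochizukiFrdI2008, Prop. 2.9(ii) p.55] -/
theorem psiHom_comp {A B E : C} (hA : P.obj A) (hB : P.obj B) (hE : P.obj E) (φ₁ : A ⟶ B) (φ₂ : B ⟶ E) :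
    psiHom hF τ histr hup hpair ζ hA hE (φ₁ ≫ φ₂) =
      psiHom hF τ histr hup hpair ζ hA hB φ₁ ≫ psiHom hF τ histr hup hpair ζ hB hE φ₂ := by
  have hP := hpair.isBaseSection
  have hFr := hpair.isFrobeniusSection
  set t₁ := factorOf hF hpair hA hB φ₁
  set t₂ := factorOf hF hpair hB hE φ₂
  have h₁ : frob Fr t₁.1 hA ≫ (t₁.2.1.1 : A ⟶ A) ≫ t₁.2.2.1 = φ₁ := toHom_factorOf hF hpair hA hB φ₁
  have h₂ : frob Fr t₂.1 hB ≫ (t₂.2.1.1 : B ⟶ B) ≫ t₂.2.2.1 = φ₂ := toHom_factorOf hF hpair hB hE φ₂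
  have hcomp := factor_comp hF hP hFr hnorm hA hB t₁.1 t₂.1 t₁.2.1 t₂.2.1 t₁.2.2.2 t₂.2.2.1
  rw [h₁, h₂] at hcomp
  rw [hcomp, psiHom_factor hF τ histr hup hpair ζ hA hE (t₂.1 * t₁.1) _ (P.hom_comp _ _ t₁.2.2.2 t₂.2.2.2)]
  conv_rhs => rw [← h₁, ← h₂]
  rw [psiHom_factor hF τ histr hup hpair ζ hA hB t₁.1 t₁.2.1 t₁.2.2.2,
    psiHom_factor hF τ histr hup hpair ζ hB hE t₂.1 t₂.2.1 t₂.2.2.2,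
    factor_comp hF hP hFr hnorm hA hB t₁.1 t₂.1 _ _ t₁.2.2.2 t₂.2.2.1, map_mul, map_pow,
    zetaUnitMap_resP hF hup ζ τ hP (histr A) (histr B)]

/-- `F(Ψ_P φ) = F(φ)`: `Ψ_A(β)` and `β` are base-identity linear endomorphisms with the same divisor.
[cite: MochizukiFrdI2008, Prop. 2.9(ii) p.55] -/
theorem map_psiHom {A B : C} (hA : P.obj A) (hB : P.obj B) (φ : A ⟶ B) :
    F.map (psiHom hF τ histr hup hpair ζ hA hB φ) = F.map φ := by
  set t := factorOf hF hpair hA hB φ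
  have h : frob Fr t.1 hA ≫ (t.2.1.1 : A ⟶ A) ≫ t.2.2.1 = φ := toHom_factorOf hF hpair hA hB φ
  have hβ : F.map ((zetaUnitMap hF hup ζ τ (histr A) t.2.1).1 : A ⟶ A) = F.map (t.2.1.1 : A ⟶ A) :=
    ElemFrobenioid.Hom.ext
      (((zetaUnitMap hF hup ζ τ (histr A) t.2.1).2.1).trans t.2.1.2.1.symm)
      (divHom_zetaUnitMap hF hup ζ τ (histr A) t.2.1)
      (((zetaUnitMap hF hup ζ τ (histr A) t.2.1).2.2).trans t.2.1.2.2.symm)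
  conv_rhs => rw [← h]
  show F.map (frob Fr t.1 hA ≫ _ ≫ t.2.2.1) = _
  rw [F.map_comp, F.map_comp, F.map_comp, F.map_comp, hβ]

/-! ### The retraction onto `P` and the functor `Ψ` -/

/-- A chosen object `A_P ∈ Ob(P)` over (an object isomorphic to) `A_D`. [cite: MochizukiFrdI2008, Prop. 2.9(ii) p.54] -/
def repP (A : C) : P.Cat :=
  haveI := hpair.isBaseSection.isEquivalence
  (P.toBase F).objPreimage (baseObj F A)

/-- `A_P` lies in `P`. [cite: MochizukiFrdI2008, Prop. 2.9(ii) p.54] -/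
theorem repP_mem (A : C) : P.obj (repP hpair A).1 := (repP hpair A).2

include hbt in
/-- `A ≅ A_P` (base-triviality). [cite: MochizukiFrdI2008, Prop. 2.9(ii) p.54] -/
theorem nonempty_iso_repP (A : C) : Nonempty (A ≅ (repP hpair A).1) := by
  haveI := hpair.isBaseSection.isEquivalence
  obtain ⟨e⟩ := hbt A (repP hpair A).1 ⟨((P.toBase F).objObjPreimageIso (baseObj F A)).symm⟩
  exact ⟨e.symm⟩

/-- The chosen isomorphism `i_A : A ≅ A_P`. [cite: MochizukiFrdI2008, Prop. 2.9(ii) p.54] -/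
def repIso (A : C) : A ≅ (repP hpair A).1 := Classical.choice (nonempty_iso_repP hbt hpair A)

include hnorm in
/-- **The unit-wise Frobenius functor `Ψ : C → C`** associated to `(τ, ζ)`:
`Ψ(A) := A_P`, `Ψ(φ) := Ψ_P(i_A⁻¹ ; φ ; i_B)`. [cite: MochizukiFrdI2008, Prop. 2.9(ii) p.53] -/
def psi : C ⥤ C where
  obj A := (repP hpair A).1
  map {A B} φ := psiHom hF τ histr hup hpair ζ (repP_mem hpair A) (repP_mem hpair B)
    ((repIso hbt hpair A).inv ≫ φ ≫ (repIso hbt hpair B).hom)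
  map_id A := by
    simp only [Category.id_comp, Iso.inv_hom_id]
    exact psiHom_id hF τ histr hup hpair ζ _
  map_comp {A B E} φ ψ := by
    rw [← psiHom_comp hF τ hnorm histr hup hpair ζ]
    simp only [Category.assoc, Iso.hom_inv_id_assoc]

/-- `Ψ` on arrows. [cite: MochizukiFrdI2008, Prop. 2.9(ii) p.54] -/
theorem psi_map {A B : C} (φ : A ⟶ B) :
    (psi hF τ hnorm hbt histr hup hpair ζ).map φ =
      psiHom hF τ histr hup hpair ζ (repP_mem hpair A) (repP_mem hpair B)
        ((repIso hbt hpair A).inv ≫ φ ≫ (repIso hbt hpair B).hom) := rfl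

/-! ### (a): `1`-compatibility with the identity of `F_Φ` -/

/-- `Ψ ⋙ F ≅ F`, with components `F(i_A)⁻¹`. [cite: MochizukiFrdI2008, Prop. 2.9(ii) p.55] -/
def psiCompIso : psi hF τ hnorm hbt histr hup hpair ζ ⋙ F ≅ F ⋙ 𝟭 (ElemFrobenioid Φ) :=
  NatIso.ofComponents (fun A => F.mapIso (repIso hbt hpair A).symm) (by
    intro A B φ
    show F.map ((psi hF τ hnorm hbt histr hup hpair ζ).map φ) ≫ F.map (repIso hbt hpair B).inv =
      F.map (repIso hbt hpair A).inv ≫ F.map φ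
    rw [psi_map]
    erw [map_psiHom]
    rw [← F.map_comp, ← F.map_comp]
    erw [Category.assoc, Category.assoc, Iso.hom_inv_id, Category.comp_id]
    rfl)

/-- **Prop. 2.9 (ii)(a)**: `Ψ` is `1`-compatible, relative to `C → F_Φ`, with the identity functor on
`F_Φ`. [cite: MochizukiFrdI2008, Prop. 2.9(ii) p.53] -/
theorem psi_oneCommutes : OneCommutes (psi hF τ hnorm hbt histr hup hpair ζ) F F (𝟭 (ElemFrobenioid Φ)) :=
  ⟨psiCompIso hF τ hnorm hbt histr hup hpair ζ⟩

end UnitWiseFrobeniusZeta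

end PreFrobenioid

end Literature.AlgebraicGeometry.Frobenioids
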